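import Literature.AlgebraicGeometry.Motives.AbelianVarietyPoincareSplitting
import Mathlib.LinearAlgebra.TensorProduct.Basic
import HarnessLib

/-!
# Equivariant quasi-retractions: Poincaré complements stable under a group or ring action

Sequel of `Motives/AbelianVarietyPoincareSplitting` (any ground field `K`). There, a
quasi-retraction `h : X ⟶ Y` of `i : Y ⟶ X` (`i ≫ h = N • 𝟙 Y`, `N ≠ 0`) produces the Poincaré
complement `Z = im (N • 𝟙 X - h ≫ i)`. When `X` and `Y` carry compatible actions — of a finite
group `G` (`ρ : G →* End X`, `ρ' : G →* End Y`), or of a ring `R` (`φ : R →+* End X`,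
`ψ : R →+* End Y`, e.g. an order of a CM field acting by complex multiplication) — and `i` is
equivariant, the complement is stable under the action as soon as `h` is equivariant, and an
equivariant quasi-retraction is obtained from an arbitrary one by **averaging**:

* `AbelianVariety.exists_equivariant_quasiRetraction_of_fintype` — finite group: with
  `h̃ = ∑_g ρ g ≫ h ≫ ρ' g⁻¹` one has `i ≫ h̃ = (#G · N) • 𝟙 Y` and `ρ g ≫ h̃ = h̃ ≫ ρ' g`
  (Maschke's averaging; Lange–Rodríguez, *Decomposition of Jacobians by Prym Varieties*,
  Thm. 2.7.1 "Poincaré's complete reducibility theorem with `G`-action" = Birkenhake–Lange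
  Thm. 13.5.2, where it is deduced from a `G`-invariant polarization instead);
* `AbelianVariety.exists_equivariant_quasiRetraction_of_separable` — ring `R` with a
  **separability datum** `(aₖ, bₖ)ₖ`, `d ≠ 0`: `∑ aₖ bₖ = d` and
  `∑ (r aₖ) ⊗ bₖ = ∑ aₖ ⊗ (bₖ r)` in `R ⊗_ℤ R` for all `r` (a multiple of a separability
  idempotent; it exists for every order in a number field, `d` a multiple of the discriminant):
  with `h̃ = ∑ₖ φ bₖ ≫ h ≫ ψ aₖ` one has `i ≫ h̃ = (N d) • 𝟙 Y` and `φ r ≫ h̃ = h̃ ≫ ψ r` — the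
  classical projection onto `R`-linear maps by a separability idempotent (Pierce, *Associative
  Algebras*, §10.2; DeMeyer–Ingraham, *Separable Algebras over Commutative Rings*, II Prop. 1.1);
* `AbelianVariety.comp_complementEndo_of_equivariant` — for an equivariant quasi-retraction the
  endomorphism `v = M • 𝟙 X - h̃ ≫ i` cutting out the complement commutes with the action, so the
  Poincaré complement `im v` of `Motives/AbelianVarietyPoincareSplitting` and the quasi-inverse
  pair `(i, j)`, `(h̃, v̄)` are compatible with the action (Poincaré's complete reducibility in the
  category of abelian varieties with `G`- resp. `R`-action up to isogeny).

Combined with `exists_quasiRetraction_of_perfectField` (`Motives/AbelianVarietyPoincarePerfectField`)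
this gives, over any perfect field, action-stable Poincaré complements of action-stable abelian
subvarieties. Everything is proved; no definition, no named fact (D-0026).

## References

* D. Mumford, *Abelian Varieties* (1970), §19 Thm. 1 and proof of Cor. 2 (pp. 173–174).
  [MumfordAV1970]
* H. Lange, R. E. Rodríguez, *Decomposition of Jacobians by Prym Varieties*, LNM 2310 (2022),
  §2.7, Thm. 2.7.1 (Poincaré's complete reducibility theorem with `G`-action; held copy
  `book:lange2022-decomposition-jacobians-by-prym-varieties`, PDF p. 38). [LangeRodriguez2022]
* R. S. Pierce, *Associative Algebras*, GTM 88 (1982), §10.2 (separability idempotents and the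
  projection onto bimodule homomorphisms). [Pierce1982]
-/

noncomputable section

universe u v

open CategoryTheory CategoryTheory.Limits AlgebraicGeometry
open scoped TensorProduct

namespace Literature.AlgebraicGeometry.Motives

namespace AbelianVariety

variable {K : Type u} [Field K] {X Y : AbelianVariety K}

/-! ### Finite group actions: Maschke averaging -/

section FiniteGroup

variable {G : Type v} [Group G] [Fintype G] (ρ : G →* End X) (ρ' : G →* End Y)

omit [Fintype G] in
/-- `ρ' g ≫ ρ' g⁻¹ = 𝟙` for a monoid homomorphism `ρ' : G →* End Y` (composition in `End` is
reversed multiplication). [folklore] -/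
private theorem act_comp_act_inv (g : G) : End.asHom (ρ' g) ≫ End.asHom (ρ' g⁻¹) = 𝟙 Y := by
  change ρ' g⁻¹ * ρ' g = 1
  rw [← map_mul, inv_mul_cancel, map_one]

/-- **Maschke averaging of a quasi-retraction.** Let a finite group `G` act on `X` and `Y`
(`ρ`, `ρ'`), let `i : Y ⟶ X` be equivariant (`i ≫ ρ g = ρ' g ≫ i`) with a quasi-retraction
`h`, `i ≫ h = N • 𝟙 Y`. Then `h̃ = ∑_g ρ g ≫ h ≫ ρ' g⁻¹` is an EQUIVARIANT quasi-retraction: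
`i ≫ h̃ = (#G · N) • 𝟙 Y` and `ρ g ≫ h̃ = h̃ ≫ ρ' g` for all `g` — the averaging step of
Poincaré's complete reducibility theorem with `G`-action.
[cite: LangeRodriguez2022, Thm. 2.7.1] [cite: MumfordAV1970, §19 Thm. 1 (p. 173)] -/
theorem exists_equivariant_quasiRetraction_of_fintype {i : Y ⟶ X} {h : X ⟶ Y} {N : ℕ}
    (hi : ∀ g : G, i ≫ End.asHom (ρ g) = End.asHom (ρ' g) ≫ i) (hih : i ≫ h = N • 𝟙 Y) :
    ∃ h' : X ⟶ Y, i ≫ h' = (Fintype.card G * N) • 𝟙 Y ∧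
      ∀ g : G, End.asHom (ρ g) ≫ h' = h' ≫ End.asHom (ρ' g) := by
  refine ⟨∑ g : G, End.asHom (ρ g) ≫ h ≫ End.asHom (ρ' g⁻¹), ?_, fun k ↦ ?_⟩
  · rw [Preadditive.comp_sum]
    have e : ∀ g : G, i ≫ End.asHom (ρ g) ≫ h ≫ End.asHom (ρ' g⁻¹) = N • 𝟙 Y := fun g ↦ by
      rw [← Category.assoc, hi g, Category.assoc, ← Category.assoc i h, hih,
        Preadditive.nsmul_comp, Category.id_comp, Preadditive.comp_nsmul, act_comp_act_inv]
    rw [Finset.sum_congr rfl fun g _ ↦ e g, Finset.sum_const, smul_smul, Finset.card_univ]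
  · rw [Preadditive.comp_sum, Preadditive.sum_comp]
    -- reindex the left sum along `g ↦ g k⁻¹`
    refine Fintype.sum_equiv (Equiv.mulRight k) _ _ fun g ↦ ?_
    have e1 : End.asHom (ρ k) ≫ End.asHom (ρ g) = End.asHom (ρ (g * k)) := by
      change ρ g * ρ k = ρ (g * k)
      rw [map_mul]
    have e2 : End.asHom (ρ' g⁻¹) = End.asHom (ρ' (g * k)⁻¹) ≫ End.asHom (ρ' k) := by
      change ρ' g⁻¹ = ρ' k * ρ' (g * k)⁻¹
      rw [← map_mul, mul_inv_rev, mul_inv_cancel_left]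
    simp only [Equiv.coe_mulRight, Category.assoc]
    rw [← Category.assoc (End.asHom (ρ k)), e1, e2]

end FiniteGroup

/-! ### Ring actions with a separability datum -/

section Separable

variable {R : Type v} [CommRing R] (φ : R →+* End X) (ψ : R →+* End Y)

/-- **Averaging a quasi-retraction by a separability datum.** Let a commutative ring `R` act on
`X` and `Y` (`φ : R →+* End X`, `ψ : R →+* End Y`), let `i : Y ⟶ X` be `R`-equivariant
(`i ≫ φ r = ψ r ≫ i`) with a quasi-retraction `h`, `i ≫ h = N • 𝟙 Y`, and let `(aₖ, bₖ)ₖ`, `d`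
be a SEPARABILITY DATUM for `R` over `ℤ`: `∑ₖ aₖ bₖ = d` and `∑ₖ (r aₖ) ⊗ bₖ = ∑ₖ aₖ ⊗ (bₖ r)` in
`R ⊗_ℤ R` for all `r ∈ R`. Then `h̃ = ∑ₖ φ bₖ ≫ h ≫ ψ aₖ` is an `R`-EQUIVARIANT quasi-retraction:
`i ≫ h̃ = (N d) • 𝟙 Y` and `φ r ≫ h̃ = h̃ ≫ ψ r`. (The projection `f ↦ ∑ aₖ f bₖ` onto
bimodule homomorphisms by a separability idempotent.) [cite: Pierce1982, §10.2]
[cite: MumfordAV1970, §19 Thm. 1 and proof of Cor. 2 (pp. 173–174)] -/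
theorem exists_equivariant_quasiRetraction_of_separable {ι : Type*} [Fintype ι] (a b : ι → R)
    (d : ℕ) (hd : ∑ k, a k * b k = d)
    (he : ∀ r : R, ∑ k, (r * a k) ⊗ₜ[ℤ] b k = ∑ k, a k ⊗ₜ[ℤ] (b k * r))
    {i : Y ⟶ X} {h : X ⟶ Y} {N : ℕ}
    (hi : ∀ r : R, i ≫ End.asHom (φ r) = End.asHom (ψ r) ≫ i) (hih : i ≫ h = N • 𝟙 Y) :
    ∃ h' : X ⟶ Y, i ≫ h' = (N * d) • 𝟙 Y ∧
      ∀ r : R, End.asHom (φ r) ≫ h' = h' ≫ End.asHom (ψ r) := by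
  refine ⟨∑ k, End.asHom (φ (b k)) ≫ h ≫ End.asHom (ψ (a k)), ?_, fun r ↦ ?_⟩
  · rw [Preadditive.comp_sum]
    have e : ∀ k, i ≫ End.asHom (φ (b k)) ≫ h ≫ End.asHom (ψ (a k)) =
        N • End.asHom (ψ (a k * b k)) := fun k ↦ by
      rw [← Category.assoc, hi (b k), Category.assoc, ← Category.assoc i h, hih,
        Preadditive.nsmul_comp, Category.id_comp, Preadditive.comp_nsmul, map_mul]
      rfl
    rw [Finset.sum_congr rfl fun k _ ↦ e k, ← Finset.smul_sum, mul_smul]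
    congr 1
    rw [show (∑ k, End.asHom (ψ (a k * b k))) = End.asHom (ψ (∑ k, a k * b k)) by
      rw [map_sum]; rfl, hd, map_natCast, ← nsmul_one]
    rfl
  · -- the `ℤ`-bilinear map `(a, b) ↦ φ b ≫ h ≫ ψ a` out of `R ⊗_ℤ R`
    obtain ⟨L, hL⟩ : ∃ L : R ⊗[ℤ] R →ₗ[ℤ] (X ⟶ Y),
        ∀ a b : R, L (a ⊗ₜ[ℤ] b) = End.asHom (φ b) ≫ h ≫ End.asHom (ψ a) := by
      refine ⟨TensorProduct.lift (LinearMap.mk₂ ℤ (fun a b ↦ End.asHom (φ b) ≫ h ≫ End.asHom (ψ a))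
        (fun a a' b ↦ ?_) (fun n a b ↦ ?_) (fun a b b' ↦ ?_) (fun n a b ↦ ?_)), fun a b ↦ by simp⟩
      · change End.asHom (φ b) ≫ h ≫ End.asHom (ψ (a + a')) = _
        rw [map_add]
        change End.asHom (φ b) ≫ h ≫ (End.asHom (ψ a) + End.asHom (ψ a')) = _
        rw [Preadditive.comp_add, Preadditive.comp_add]
      · change End.asHom (φ b) ≫ h ≫ End.asHom (ψ (n • a)) =
          n • (End.asHom (φ b) ≫ h ≫ End.asHom (ψ a))
        rw [map_zsmul]
        change End.asHom (φ b) ≫ h ≫ (n • End.asHom (ψ a)) = _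
        rw [Preadditive.comp_zsmul, Preadditive.comp_zsmul]
      · change End.asHom (φ (b + b')) ≫ h ≫ End.asHom (ψ a) = _
        rw [map_add]
        change (End.asHom (φ b) + End.asHom (φ b')) ≫ h ≫ End.asHom (ψ a) = _
        rw [Preadditive.add_comp]
      · change End.asHom (φ (n • b)) ≫ h ≫ End.asHom (ψ a) =
          n • (End.asHom (φ b) ≫ h ≫ End.asHom (ψ a))
        rw [map_zsmul]
        change (n • End.asHom (φ b)) ≫ h ≫ End.asHom (ψ a) = _
        rw [Preadditive.zsmul_comp]
    rw [Preadditive.comp_sum, Preadditive.sum_comp]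
    have e1 : ∀ k, End.asHom (φ r) ≫ End.asHom (φ (b k)) ≫ h ≫ End.asHom (ψ (a k)) =
        L (a k ⊗ₜ[ℤ] (b k * r)) := fun k ↦ by
      rw [hL, map_mul]
      rfl
    have e2 : ∀ k, (End.asHom (φ (b k)) ≫ h ≫ End.asHom (ψ (a k))) ≫ End.asHom (ψ r) =
        L ((r * a k) ⊗ₜ[ℤ] b k) := fun k ↦ by
      rw [hL, map_mul, Category.assoc, Category.assoc]
      rfl
    simp_rw [e1, e2, ← map_sum, he r]

end Separable

/-! ### The complement of an equivariant quasi-retraction is stable under the action -/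

/-- **Equivariant quasi-retractions cut out action-stable complements.** If `u : X ⟶ X` and
`u' : Y ⟶ Y` are intertwined by `i` (`i ≫ u = u' ≫ i`) and by the quasi-retraction `h`
(`u ≫ h = h ≫ u'`), then the endomorphism `v = M • 𝟙 X - h ≫ i` of
`Motives/AbelianVarietyPoincareSplitting` (whose image is the Poincaré complement of `Y`)
commutes with `u`: `u ≫ v = v ≫ u`. [cite: MumfordAV1970, §19 Thm. 1 and proof of Cor. 2 (pp. 173–174)] -/
theorem comp_complementEndo_of_equivariant {i : Y ⟶ X} {h : X ⟶ Y} (M : ℕ) {u : X ⟶ X}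
    {u' : Y ⟶ Y} (hi : i ≫ u = u' ≫ i) (hh : u ≫ h = h ≫ u') :
    u ≫ (M • 𝟙 X - h ≫ i) = (M • 𝟙 X - h ≫ i) ≫ u := by
  rw [Preadditive.comp_sub, Preadditive.sub_comp, Preadditive.comp_nsmul, Preadditive.nsmul_comp,
    Category.comp_id, Category.id_comp, ← Category.assoc, hh, Category.assoc, ← hi, Category.assoc]

end AbelianVariety

end Literature.AlgebraicGeometry.Motives
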